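import Summits.QuantumFields.BalabanUV.Beta.FP.CombSliceRowJets

/-!
# `BalabanUV.Beta.FP.CombSliceExpRowJets` — road «FP» for binder row D1, ROUTE T (presentation T-β, the OWNER's S1 v1.1 `_of_uni` socket `uP♯`):
# **EXPONENTIALLY GENERATED INSERTION JETS HAVE ZERO ONE-SHOT FADDEEV–POPOV 2-JET AT EVERY SLOT — LIVE OR DEAD, NO INVERTIBILITY ASKED**

WHAT.  `CombSliceRowJets` (leaf-06 g17, p314465) computes the displayed one-shot FP 2-jet `secondVar (P·W₀) (P·W₁) (P·W₂)` along a row-ultralocal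
generator jet: `0` at a LIVE insertion slot, `d₂ − d₁²` at a DEAD one.  For the one-shot literal's BARE bond insertions the jets are EXPONENTIALLY
GENERATED on the field side, `W₁ = X♯·W₀`, `W₂ = X♯·X♯·W₀` with `X♯` a DIAGONAL field multiplication (one slot: `X♯ = diagonal (Pi.single b μ)`, i.e.
`W₁ b = μ•W₀ b`, `W₂ b = μ²•W₀ b`, other rows `0`), and then the dead-slot letter `d₂ = d₁²` holds AUTOMATICALLY (`d₁ = μ·d₀`, `d₂ = μ²·d₀`, `d₀ = d₀² = 1`
— or `d₀ = 0` when `P·W₀` is singular, where `secondVar` reads `A₀⁻¹ := 0`).  This file proves it WITHOUT the case split and WITHOUT invertibility: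
* §1 `secondVar_leftExpJets A₀ Y : secondVar A₀ (Y·A₀) (Y·Y·A₀) = 0` for ALL square `A₀ Y` — the conjugate of `ExponentialTransportJets.secondVar_expJet`
  (`log|det(e^{uY}·A₀)| = u·tr Y + const`; for singular `A₀` both traces vanish since `Matrix.nonsing_inv` is `0` there).
* §2 comb bookkeeping: `fieldSlot_eq_iff`, `exists_fieldSlot_eq_combBondT` (every comb bond IS a field slot — no hypotheses), and
  **`combSlice_mul_diagonal`**: the comb slice `P` (comb rows re-indexed by any `e : Res ≃ o`, read on the field slots, bound by a defining equation `hP`)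
  INTERTWINES diagonal multiplications: `P · diagonal w = diagonal w♭ · P`, `w♭ i := Σ_q P i q · w q` (each comb row reads exactly one slot).
* §3 **`secondVar_combSlice_diagExpJets_eq_zero`**: `secondVar (P·W₀) (P·(diagonal w·W₀)) (P·(diagonal w·diagonal w·W₀)) = 0` for ANY `w`, ANY `W₀`;
  **`secondVar_combSlice_expRowJets_eq_zero`**: the single-row form (`W₁ W₂` supported on row `b`, `W₁ b = μ•W₀ b`, `W₂ b = (μ·μ)•W₀ b`) at ANY slot `b`.
* §4 AT THE TORUS CALL's LITERAL `P` (the `hP` of `NestedStepLawTorusInstanceDelta` ∕ `NestedStepLawTorusTransported`, p316503 ∕ p320614, VERBATIM):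
  `secondVar_bigCombSlice_diagExpJets_eq_zero`, **`secondVar_bigCombSlice_expRowJets_eq_zero`** (the name OFFER O-d1leaf06g18-1 promised as `…_of_dead`,
  now hypothesis-free), and the `uP♯`-shaped socket **`torus_uP_of_diagExpJets`** (`W♯₁ = X♯·W₀`, `W♯₂ = X♯·X♯·W₀`, `X♯ = diagonal w` ⇒ `uP♯`).

HONEST DEPENDENCY (page 1, mandatory): continuum YM on T⁴ ⇐ BetaPertH ∧ nine spine estimates (0/9 proved); BetaPertH ⇐ (D1) ∧ (D4) ∧ CAP+tail;
G-an2-4 gates asym, D1 and NE2/3/4.  HONEST FRAMING (cell contract, verbatim): «discharging `BetaPertH` makes Bałaban's UV stability UNCONDITIONAL —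
a real constructive-QFT result; it is NOT the continuum limit and NOT the Clay problem.»  ABSOLUTE RULE (cell charter, verbatim): «No internally-minted
statement may enter as a cited fact. Every hypothesis is either kernel-proved in this package or a verbatim quotation of a PUBLISHED theorem with page
reference. The manuscript(s) under audit are NOT citable for their own disputed steps — they are the thing under adjudication; programme-internal
(2001/route/tribunal) claims are never citable.»  THIS MODULE is [folklore] finite-matrix algebra (`Matrix.nonsing_inv`, `Matrix.diagonal`, `Pi.single`)
over `FP/CombSliceRowJets` ∕ `FP/TorusCombRows` and road BF-x's `LogDetSecondVariation.secondVar`; no `def`, no `def … : Prop`, nothing cited, 0 sorry;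
0 estimates; 0∕4 row-D1 binders.  NOT the statement that the dictionary's one-shot jets ARE exponentially generated (that is the dictionary's ∕ the OWNER's
`_of_uni` instance to display), NOT Haar-type jets (`(1, ½·adE, ⅙·(adE)²)` is NOT of this form and gives `−(adE)²∕12`), NOT (T-ID), NOT SDF, NOT D1,
NOT BetaPertH, NOT continuum, NOT Clay.  «not in print; our bookkeeping».
Provenance: D1 formalisation swarm LEAF PROVER 06, unit b2b-balaban-beta-d1-formalise-leaf-06 gen 18, 2026-08-22 (OFFER O-d1leaf06g18-1, the OWNER d1-p3 g18's
«WANTED — GO» [D1P3-G18-LANDED-3]; a sibling file rather than a v1.2 append of `CombSliceRowJets` only because of the 400-line cap).  No existing file touched.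
-/

noncomputable section

namespace Summit.QuantumFields.BalabanUV.Beta.FP.CombSliceExpRowJets

open Finset Matrix
open Literature.MathematicalPhysics.QuantumFieldTheory.Balaban1983to89
open Literature.MathematicalPhysics.QuantumFieldTheory.Balaban1983to89.Beta
open B5Prop11Plancherel (fine)
open AffineAveraging (Site box toSite)
open B6Lemma24Torus (pbox)
open OneStepResolventKernel (Fib)
open Summit.QuantumFields.BalabanUV.Beta.D1BFx.LogDetSecondVariation (secondVar)
open Summit.QuantumFields.BalabanUV.Beta.FP.KernelPeriodisationFib (Idx)
open Summit.QuantumFields.BalabanUV.Beta.FP.TorusCombForest (baseOf axisOf)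
open Summit.QuantumFields.BalabanUV.Beta.FP.TorusCombRows (Res combBondT combRowsT)
open Summit.QuantumFields.BalabanUV.Beta.FP.TorusCombNestedBasis (resBigEquiv)
open Summit.QuantumFields.BalabanUV.Beta.FP.CombSliceRowJets (combRowsT_reindex_fieldSlot_apply)
open Summit.QuantumFields.BalabanUV.Beta.GAN24.FineReadoutCauchyFrame (toSite_mem_range)

variable {d : ℕ}

/-! ## §1 Generic: exponentially LEFT-generated jets have zero `secondVar`, for any zeroth jet -/

section Generic

variable {ι : Type*} [Fintype ι] [DecidableEq ι]

/-- [folklore] **`secondVar A₀ (Y·A₀) (Y·Y·A₀) = 0` FOR ALL SQUARE `A₀`, `Y`** — the 2-jet of `u ↦ e^{uY}·A₀` (`log|det| = u·tr Y + const`); the conjugate of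
`ExponentialTransportJets.secondVar_expJet` (`A₀ = 1`).  No invertibility: for singular `A₀`, `A₀⁻¹ = 0` (`Matrix.nonsing_inv_apply_not_isUnit`) and both
traces vanish. -/
theorem secondVar_leftExpJets (A₀ Y : Matrix ι ι ℝ) : secondVar A₀ (Y * A₀) (Y * Y * A₀) = 0 := by
  by_cases hA : IsUnit A₀.det
  · have h1 : A₀ * A₀⁻¹ = 1 := Matrix.mul_nonsing_inv A₀ hA
    have e : A₀⁻¹ * (Y * A₀) * (A₀⁻¹ * (Y * A₀)) = A₀⁻¹ * (Y * Y * A₀) := by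
      calc A₀⁻¹ * (Y * A₀) * (A₀⁻¹ * (Y * A₀)) = A₀⁻¹ * Y * (A₀ * A₀⁻¹) * (Y * A₀) := by simp only [Matrix.mul_assoc]
        _ = A₀⁻¹ * (Y * Y * A₀) := by rw [h1, Matrix.mul_one]; simp only [Matrix.mul_assoc]
    rw [secondVar, e, sub_self]
  · simp only [secondVar, Matrix.nonsing_inv_apply_not_isUnit _ hA, Matrix.zero_mul, Matrix.trace_zero, sub_self]

end Generic

/-! ## §2 Comb bookkeeping: every comb row reads exactly one field slot; the slice intertwines diagonal multiplications -/

section Comb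

variable {N : ℕ} {ρ : Site (d + 1)} {M : Fin (d + 1) → ℕ} {o : Type*}

/-- [folklore] field slots are determined by their base point and axis. -/
theorem fieldSlot_eq_iff (q q' : ↥(pbox M) × Fin (d + 1)) :
    ((q'.1, Sum.inl q'.2) : Idx M (Fib d)) = ((q.1, Sum.inl q.2) : Idx M (Fib d)) ↔ q' = q := by
  constructor
  · intro h
    obtain ⟨h1, h2⟩ := Prod.mk.inj h
    exact Prod.ext h1 (Sum.inl_injective h2)
  · rintro rfl
    rfl

/-- [folklore] **EVERY COMB BOND IS A FIELD SLOT** (both branches of `combBondT` carry `Sum.inl (axisOf _)`; no hypotheses). -/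
theorem exists_fieldSlot_eq_combBondT (x : Res ρ N M) :
    ∃ b : ↥(pbox M) × Fin (d + 1), ((b.1, Sum.inl b.2) : Idx M (Fib d)) = combBondT ρ N M x := by
  unfold combBondT
  split_ifs with h
  · exact ⟨(⟨baseOf ρ N x.site, h⟩, axisOf ρ N x.site), rfl⟩
  · exact ⟨(x.1, axisOf ρ N x.site), rfl⟩

/-- [folklore] **A COMB ROW IS THE INDICATOR OF ONE FIELD SLOT**: row `i` of the re-indexed comb slice is `q ↦ [q = b₀]` for the slot `b₀` of the comb bond
into `e.symm i`. -/
theorem combSlice_row_eq_indicator (e : Res ρ N M ≃ o) {P : Matrix o (↥(pbox M) × Fin (d + 1)) ℝ}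
    (hP : P = (combRowsT ρ N M).submatrix e.symm (fun b : ↥(pbox M) × Fin (d + 1) => ((b.1, Sum.inl b.2) : Idx M (Fib d)))) (i : o)
    {b₀ : ↥(pbox M) × Fin (d + 1)} (hb₀ : ((b₀.1, Sum.inl b₀.2) : Idx M (Fib d)) = combBondT ρ N M (e.symm i)) (q : ↥(pbox M) × Fin (d + 1)) :
    P i q = if q = b₀ then 1 else 0 := by
  rw [hP, combRowsT_reindex_fieldSlot_apply, ← hb₀]
  by_cases hq : q = b₀
  · rw [if_pos hq, if_pos (by rw [hq])]
  · rw [if_neg hq, if_neg (fun h => hq ((fieldSlot_eq_iff b₀ q).1 h))]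

/-- [folklore] **THE COMB SLICE INTERTWINES DIAGONAL MULTIPLICATIONS**: `P · diagonal w = diagonal w♭ · P` with `w♭ i := Σ_q P i q · w q` (= the value
of `w` at the comb bond into `e.symm i`; each comb row reads exactly one field slot). -/
theorem combSlice_mul_diagonal [Fintype o] [DecidableEq o] (e : Res ρ N M ≃ o) {P : Matrix o (↥(pbox M) × Fin (d + 1)) ℝ}
    (hP : P = (combRowsT ρ N M).submatrix e.symm (fun b : ↥(pbox M) × Fin (d + 1) => ((b.1, Sum.inl b.2) : Idx M (Fib d))))
    (w : ↥(pbox M) × Fin (d + 1) → ℝ) :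
    P * Matrix.diagonal w = Matrix.diagonal (fun i => ∑ q, P i q * w q) * P := by
  ext i q
  obtain ⟨b₀, hb₀⟩ := exists_fieldSlot_eq_combBondT (e.symm i)
  have hrow : ∀ q', P i q' = if q' = b₀ then 1 else 0 := combSlice_row_eq_indicator e hP i hb₀
  have hsum : ∑ q', P i q' * w q' = w b₀ := by
    simp_rw [hrow, ite_mul, one_mul, zero_mul]
    rw [Finset.sum_ite_eq' Finset.univ b₀ w, if_pos (Finset.mem_univ _)]
  rw [Matrix.mul_diagonal, Matrix.diagonal_mul, hsum, hrow]
  by_cases hq : q = b₀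
  · rw [if_pos hq, hq, one_mul, mul_one]
  · rw [if_neg hq, zero_mul, mul_zero]

end Comb

/-! ## §3 The one-shot Faddeev–Popov 2-jet of exponentially generated jets VANISHES at every slot -/

section OneShot

variable {N : ℕ} {ρ : Site (d + 1)} {M : Fin (d + 1) → ℕ} {o : Type*} [Fintype o] [DecidableEq o]

/-- [folklore] **DIAGONALLY GENERATED EXPONENTIAL JETS ⇒ ZERO ONE-SHOT FP 2-JET, ANY `w`, ANY `W₀`**:
`secondVar (P·W₀) (P·(diagonal w·W₀)) (P·(diagonal w·diagonal w·W₀)) = 0` — `P·diagonal w = diagonal w♭·P` (§2) moves the generator to the LEFT of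
`P·W₀`, and `secondVar A₀ (Y·A₀) (Y²·A₀) = 0` (§1).  Live slots, dead slots, singular `P·W₀`: all covered. -/
theorem secondVar_combSlice_diagExpJets_eq_zero (e : Res ρ N M ≃ o) {P : Matrix o (↥(pbox M) × Fin (d + 1)) ℝ}
    (hP : P = (combRowsT ρ N M).submatrix e.symm (fun b : ↥(pbox M) × Fin (d + 1) => ((b.1, Sum.inl b.2) : Idx M (Fib d))))
    (w : ↥(pbox M) × Fin (d + 1) → ℝ) (W₀ : Matrix (↥(pbox M) × Fin (d + 1)) o ℝ) :
    secondVar (P * W₀) (P * (Matrix.diagonal w * W₀)) (P * (Matrix.diagonal w * Matrix.diagonal w * W₀)) = 0 := by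
  have h := combSlice_mul_diagonal e hP w
  have h1 : P * (Matrix.diagonal w * W₀) = Matrix.diagonal (fun i => ∑ q, P i q * w q) * (P * W₀) := by
    rw [← Matrix.mul_assoc, h, Matrix.mul_assoc]
  have h2 : P * (Matrix.diagonal w * Matrix.diagonal w * W₀)
      = Matrix.diagonal (fun i => ∑ q, P i q * w q) * Matrix.diagonal (fun i => ∑ q, P i q * w q) * (P * W₀) := by
    rw [Matrix.mul_assoc (Matrix.diagonal w), ← Matrix.mul_assoc P, h, Matrix.mul_assoc _ P, h1, ← Matrix.mul_assoc]
  rw [h1, h2]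
  exact secondVar_leftExpJets _ _

/-- [folklore] **EXPONENTIAL ROW JETS AT ANY SLOT ⇒ ZERO ONE-SHOT FP 2-JET**: for `W₁ W₂` supported on the single row `b` with `W₁ b = μ•W₀ b`,
`W₂ b = (μ·μ)•W₀ b` (the 2-jet of `u ↦ e^{uμ}` on row `b`), `secondVar (P·W₀) (P·W₁) (P·W₂) = 0` — NO live∕dead case split (cf. `CombSliceRowJets` §3:
`0` ∕ `d₂ − d₁²`; here `d₂ = μ²d₀ = (μd₀)² = d₁²` since `d₀ ∈ {0, 1}`), NO invertibility. -/
theorem secondVar_combSlice_expRowJets_eq_zero (e : Res ρ N M ≃ o) {P : Matrix o (↥(pbox M) × Fin (d + 1)) ℝ}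
    (hP : P = (combRowsT ρ N M).submatrix e.symm (fun b : ↥(pbox M) × Fin (d + 1) => ((b.1, Sum.inl b.2) : Idx M (Fib d))))
    (W₀ W₁ W₂ : Matrix (↥(pbox M) × Fin (d + 1)) o ℝ) {b : ↥(pbox M) × Fin (d + 1)} (μ : ℝ)
    (hW₁ : ∀ q, q ≠ b → W₁ q = 0) (hW₂ : ∀ q, q ≠ b → W₂ q = 0) (h₁ : W₁ b = μ • W₀ b) (h₂ : W₂ b = (μ * μ) • W₀ b) :
    secondVar (P * W₀) (P * W₁) (P * W₂) = 0 := by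
  have e₁ : W₁ = Matrix.diagonal (Pi.single b μ) * W₀ := by
    ext q c
    rw [Matrix.diagonal_mul, Pi.single_apply]
    by_cases hq : q = b
    · rw [hq, h₁, if_pos rfl, Pi.smul_apply, smul_eq_mul]
    · rw [hW₁ q hq, if_neg hq, Pi.zero_apply, zero_mul]
  have e₂ : W₂ = Matrix.diagonal (Pi.single b μ) * Matrix.diagonal (Pi.single b μ) * W₀ := by
    rw [Matrix.diagonal_mul_diagonal]
    ext q c
    rw [Matrix.diagonal_mul, Pi.single_apply]
    by_cases hq : q = b
    · rw [hq, h₂, if_pos rfl, Pi.smul_apply, smul_eq_mul]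
    · rw [hW₂ q hq, if_neg hq, Pi.zero_apply, zero_mul, zero_mul]
  rw [e₁, e₂]
  exact secondVar_combSlice_diagExpJets_eq_zero e hP (Pi.single b μ) W₀

end OneShot

/-! ## §4 At the torus call's literal one-shot slice `P` (the `hP` of p316503 ∕ p320614 verbatim) -/

section Torus

variable (M' : Fin (d + 1) → ℕ) {Lc : ℕ} [NeZero Lc] {r r' : Fin (d + 1) → ℕ}

/-- [folklore] **AT THE TORUS: DIAGONALLY GENERATED EXPONENTIAL JETS ⇒ THE DISPLAYED ONE-SHOT FP 2-JET VANISHES**, any `w`, any `W₀`. -/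
theorem secondVar_bigCombSlice_diagExpJets_eq_zero (hr : r ∈ box (d + 1) Lc) (hr' : r' ∈ box (d + 1) Lc)
    {P : Matrix (Res (toSite r') Lc M' ⊕ Res (toSite r) Lc (fine Lc M')) (↥(pbox (fine Lc M')) × Fin (d + 1)) ℝ}
    (hP : P = (combRowsT ((Lc : ℤ) • toSite r' + toSite r) (Lc * Lc) (fine Lc M')).submatrix
        (resBigEquiv Lc Lc (toSite r) (toSite r') M' (Nat.pos_of_ne_zero (NeZero.ne Lc)) (toSite_mem_range hr)
          (Nat.pos_of_ne_zero (NeZero.ne Lc)) (toSite_mem_range hr')).symm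
        (fun b : ↥(pbox (fine Lc M')) × Fin (d + 1) => ((b.1, Sum.inl b.2) : Idx (fine Lc M') (Fib d))))
    (w : ↥(pbox (fine Lc M')) × Fin (d + 1) → ℝ)
    (W₀ : Matrix (↥(pbox (fine Lc M')) × Fin (d + 1)) (Res (toSite r') Lc M' ⊕ Res (toSite r) Lc (fine Lc M')) ℝ) :
    secondVar (P * W₀) (P * (Matrix.diagonal w * W₀)) (P * (Matrix.diagonal w * Matrix.diagonal w * W₀)) = 0 :=
  secondVar_combSlice_diagExpJets_eq_zero _ hP w W₀

/-- [folklore] **AT THE TORUS: EXPONENTIAL ROW JETS AT ANY INSERTION SLOT ⇒ THE DISPLAYED ONE-SHOT FP 2-JET VANISHES** (OFFER O-d1leaf06g18-1's name,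
hypothesis-free: no dead∕live split, no `det ≠ 0`). -/
theorem secondVar_bigCombSlice_expRowJets_eq_zero (hr : r ∈ box (d + 1) Lc) (hr' : r' ∈ box (d + 1) Lc)
    {P : Matrix (Res (toSite r') Lc M' ⊕ Res (toSite r) Lc (fine Lc M')) (↥(pbox (fine Lc M')) × Fin (d + 1)) ℝ}
    (hP : P = (combRowsT ((Lc : ℤ) • toSite r' + toSite r) (Lc * Lc) (fine Lc M')).submatrix
        (resBigEquiv Lc Lc (toSite r) (toSite r') M' (Nat.pos_of_ne_zero (NeZero.ne Lc)) (toSite_mem_range hr)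
          (Nat.pos_of_ne_zero (NeZero.ne Lc)) (toSite_mem_range hr')).symm
        (fun b : ↥(pbox (fine Lc M')) × Fin (d + 1) => ((b.1, Sum.inl b.2) : Idx (fine Lc M') (Fib d))))
    (W₀ W₁ W₂ : Matrix (↥(pbox (fine Lc M')) × Fin (d + 1)) (Res (toSite r') Lc M' ⊕ Res (toSite r) Lc (fine Lc M')) ℝ)
    {b : ↥(pbox (fine Lc M')) × Fin (d + 1)} (μ : ℝ)
    (hW₁ : ∀ q, q ≠ b → W₁ q = 0) (hW₂ : ∀ q, q ≠ b → W₂ q = 0) (h₁ : W₁ b = μ • W₀ b) (h₂ : W₂ b = (μ * μ) • W₀ b) :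
    secondVar (P * W₀) (P * W₁) (P * W₂) = 0 :=
  secondVar_combSlice_expRowJets_eq_zero _ hP W₀ W₁ W₂ μ hW₁ hW₂ h₁ h₂

/-- [folklore] **THE `uP♯` SOCKET OF S1 v1.1 `_of_uni` FOR EXPONENTIALLY GENERATED ONE-SHOT JETS**: with `X♯ = diagonal w` (any `w`) and the one-shot
chart's generator jets `W♯₁ = X♯·W₀`, `W♯₂ = X♯·X♯·W₀`, `secondVar (P·W₀) (P·W♯₁) (P·W♯₂) = 0`. -/
theorem torus_uP_of_diagExpJets (hr : r ∈ box (d + 1) Lc) (hr' : r' ∈ box (d + 1) Lc)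
    {P : Matrix (Res (toSite r') Lc M' ⊕ Res (toSite r) Lc (fine Lc M')) (↥(pbox (fine Lc M')) × Fin (d + 1)) ℝ}
    (hP : P = (combRowsT ((Lc : ℤ) • toSite r' + toSite r) (Lc * Lc) (fine Lc M')).submatrix
        (resBigEquiv Lc Lc (toSite r) (toSite r') M' (Nat.pos_of_ne_zero (NeZero.ne Lc)) (toSite_mem_range hr)
          (Nat.pos_of_ne_zero (NeZero.ne Lc)) (toSite_mem_range hr')).symm
        (fun b : ↥(pbox (fine Lc M')) × Fin (d + 1) => ((b.1, Sum.inl b.2) : Idx (fine Lc M') (Fib d))))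
    {X : Matrix (↥(pbox (fine Lc M')) × Fin (d + 1)) (↥(pbox (fine Lc M')) × Fin (d + 1)) ℝ} {w : ↥(pbox (fine Lc M')) × Fin (d + 1) → ℝ}
    (hX : X = Matrix.diagonal w)
    {W₀ W'₁ W'₂ : Matrix (↥(pbox (fine Lc M')) × Fin (d + 1)) (Res (toSite r') Lc M' ⊕ Res (toSite r) Lc (fine Lc M')) ℝ}
    (hW'₁ : W'₁ = X * W₀) (hW'₂ : W'₂ = X * X * W₀) :
    secondVar (P * W₀) (P * W'₁) (P * W'₂) = 0 := by
  rw [hW'₁, hW'₂, hX]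
  exact secondVar_combSlice_diagExpJets_eq_zero _ hP w W₀

end Torus

end Summit.QuantumFields.BalabanUV.Beta.FP.CombSliceExpRowJets

end
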